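import Mathlib
import HarnessLib
import Literature.MathematicalPhysics.StatisticalMechanics.TorusFRDKernels

/-!
# Sup-metric neighbourhoods of subsets of the discrete torus (Adams–Buchholz–Kotecký–Müller,
# Ch. 6.2: `X⁺ = X + [−L^k, L^k]^d`, `X* = X + [−2^dL^{k−1}, 2^dL^{k−1}]^d`, `X^{++}`, distances)

The multiscale analysis of [ABKM19] organises the torus `T_N = (ℤ/L^N ℤ)^d` through neighbourhoods
of polymers that are all of the form "`X` thickened by a sup-norm ball" ((6.25):
`B̂ = B + [−2^dL^k, 2^dL^k]^d`, `X* = X + [−2^dL^{k−1}, 2^dL^{k−1}]^d`, `X⁺ = X + [−L^k, L^k]^d`,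
`X^{++} = (X⁺)⁺`), and through sup-norm separation of sets ("strictly disjoint `k`-polymers have
`dist(X,Y) > L^k`", `dist(X,Y) ≥ ¾L^{k+1}` in Lemma 7.6, `dist(X^{++}, Y^{++}) ≥ L^{k+1}/2` for the
finite-range factorisation (7.58)).  This file provides that elementary geometry on the torus
`(ℤ/M)^d` with the sup-norm `|x|_∞ = max_i |x_i|` of `GradientFRD.supNorm` (symmetric
representatives):

* `supNorm_sub_le`, `supNorm_sub_comm`, `two_mul_supNorm_le` (`2|x|_∞ ≤ M`) (the triangle
  inequality `supNorm_add_le` itself is in `TorusFRDKernels.lean`);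
* `ball r x` (`{y : |y − x|_∞ ≤ r}`), `thicken r X = X + [−r, r]^d` with `mem_thicken`,
  `subset_thicken`, monotonicity in `X` and `r`, `thicken_union`, `thicken_thicken`
  (`(X + [−r',r']^d) + [−r,r]^d ⊆ X + [−(r+r'), r+r']^d`), `thicken_zero`;
* `Separated D X Y` (`|x − y|_∞ ≥ D` for `x ∈ X`, `y ∈ Y`): symmetry, monotonicity, `Separated.thicken`
  (`dist(X + [−r,r]^d, Y + [−r',r']^d) ≥ dist(X,Y) − r − r'`), `Separated.disjoint`, and
  `Separated.eq_empty_or_eq_empty` (on a torus of side `M` no two non-empty sets are more than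
  `M/2` apart);
* counting: `card_ball_le` (`#ball ≤ (2r+1)^d`), `card_thicken_le`.

Everything is proved; no named fact.

## References
* S. Adams, S. Buchholz, R. Kotecký, S. Müller, arXiv:1910.13564, Ch. 6.2 (6.25)–(6.27), proof of
  Lemma 7.5 (iii) ((7.46)) and of Lemma 7.6 (i) ((7.56)–(7.58)) [AdamsBuchholzKoteckyMuller2019].
-/

namespace Literature.MathematicalPhysics.StatisticalMechanics.TorusPolymer

open Finset
open Literature.MathematicalPhysics.StatisticalMechanics.GradientFRD
  (supNorm natAbs_valMinAbs_le_supNorm supNorm_add_le supNorm_neg supNorm_eq_zero_iff)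

variable {d M : ℕ}

/-! ## The sup-norm on the torus -/

/-- `|x|_∞ ≤ r` iff every coordinate has `|x_i| ≤ r` (the sup-norm balls are the cubes `[−r,r]^d`). [cite: AdamsBuchholzKoteckyMuller2019, Ch. 6.2 (6.25)] -/
theorem supNorm_le_iff {x : Fin d → ZMod M} {r : ℕ} :
    supNorm x ≤ r ↔ ∀ i, ((x i).valMinAbs).natAbs ≤ r := by
  unfold supNorm
  rw [Finset.sup_le_iff]
  exact ⟨fun h i => h i (mem_univ i), fun h i _ => h i⟩

/-- `|0|_∞ = 0` (elementary property of `dist_∞`). [cite: AdamsBuchholzKoteckyMuller2019, Ch. 6.2] -/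
@[simp] theorem supNorm_zero : supNorm (0 : Fin d → ZMod M) = 0 := by
  apply le_antisymm _ (Nat.zero_le _)
  rw [supNorm_le_iff]
  intro i
  simp [ZMod.valMinAbs_zero]

/-- `|x − y|_∞ = |y − x|_∞` (symmetry of `dist_∞`). [cite: AdamsBuchholzKoteckyMuller2019, Ch. 6.2] -/
theorem supNorm_sub_comm (x y : Fin d → ZMod M) : supNorm (x - y) = supNorm (y - x) := by
  rw [← supNorm_neg, neg_sub]

/-- `|x − z|_∞ ≤ |x − y|_∞ + |y − z|_∞` (triangle inequality for `dist_∞`). [cite: AdamsBuchholzKoteckyMuller2019, Ch. 6.2 (6.26)] -/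
theorem supNorm_sub_le (x y z : Fin d → ZMod M) :
    supNorm (x - z) ≤ supNorm (x - y) + supNorm (y - z) := by
  have := supNorm_add_le (x - y) (y - z)
  rwa [sub_add_sub_cancel] at this

/-- On the torus of side `M` every point has `2|x|_∞ ≤ M` (the torus has `dist_∞`-diameter `≤ M/2`; this is why (w4) of Theorem 7.1 is vacuous at the last scale). [cite: AdamsBuchholzKoteckyMuller2019, Theorem 7.1 (w4)] -/
theorem two_mul_supNorm_le [NeZero M] (x : Fin d → ZMod M) : 2 * supNorm x ≤ M := by
  have h : supNorm x ≤ M / 2 := by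
    rw [supNorm_le_iff]
    exact fun i => ZMod.natAbs_valMinAbs_le _
  omega

/-! ## Balls and thickenings -/

variable [NeZero M]

/-- The sup-norm ball `{y : |y − x|_∞ ≤ r} = x + [−r, r]^d`. [cite: AdamsBuchholzKoteckyMuller2019, Ch. 6.2 (6.25)] -/
def ball (r : ℕ) (x : Fin d → ZMod M) : Finset (Fin d → ZMod M) :=
  univ.filter fun y => supNorm (y - x) ≤ r

/-- Membership in a ball. [cite: AdamsBuchholzKoteckyMuller2019, Ch. 6.2 (6.25)] -/
@[simp] theorem mem_ball {r : ℕ} {x y : Fin d → ZMod M} : y ∈ ball r x ↔ supNorm (y - x) ≤ r := by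
  simp [ball]

/-- The centre belongs to its ball. [cite: AdamsBuchholzKoteckyMuller2019, Ch. 6.2 (6.25)] -/
theorem mem_ball_self (r : ℕ) (x : Fin d → ZMod M) : x ∈ ball r x := by
  rw [mem_ball, sub_self, supNorm_zero]; exact Nat.zero_le _


/-- Symmetry of ball membership. [cite: AdamsBuchholzKoteckyMuller2019, Ch. 6.2 (6.25)] -/
theorem mem_ball_comm {r : ℕ} {x y : Fin d → ZMod M} : y ∈ ball r x ↔ x ∈ ball r y := by
  rw [mem_ball, mem_ball, supNorm_sub_comm]

/-- A set of diameter `≤ δ` within distance `r` of `x` lies in the ball of radius `r + δ` about `x`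
(e.g. a `k`-block `B` with `x ∈ B⁺` lies in `x + [−2L^k, 2L^k]^d`).
[cite: AdamsBuchholzKoteckyMuller2019, Ch. 6.2 (6.27)] -/
theorem subset_ball_of_diam {r δ R : ℕ} {B : Finset (Fin d → ZMod M)} {x : Fin d → ZMod M}
    (hdiam : ∀ b ∈ B, ∀ b' ∈ B, supNorm (b - b') ≤ δ) (hx : ∃ b ∈ B, supNorm (x - b) ≤ r)
    (hR : r + δ ≤ R) : B ⊆ ball R x := by
  intro b' hb'
  obtain ⟨b, hb, hxb⟩ := hx
  rw [mem_ball]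
  have := supNorm_sub_le b' b x
  rw [supNorm_sub_comm b x] at this
  have := hdiam b' hb' b hb
  omega

/-- **The thickening `X + [−r, r]^d`** of a set of torus points (`X⁺`, `X*`, `X^{++}`, `B̂` of
[ABKM19] (6.25) are all of this form). [cite: AdamsBuchholzKoteckyMuller2019, Ch. 6.2 (6.25)] -/
def thicken (r : ℕ) (X : Finset (Fin d → ZMod M)) : Finset (Fin d → ZMod M) :=
  X.biUnion (ball r)

/-- Membership in a thickening: `y ∈ X + [−r,r]^d ↔ ∃ x ∈ X, |y − x|_∞ ≤ r`.
[cite: AdamsBuchholzKoteckyMuller2019, Ch. 6.2 (6.25)] -/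
theorem mem_thicken {r : ℕ} {X : Finset (Fin d → ZMod M)} {y : Fin d → ZMod M} :
    y ∈ thicken r X ↔ ∃ x ∈ X, supNorm (y - x) ≤ r := by
  simp [thicken]

/-- `X ⊆ X + [−r,r]^d`. [cite: AdamsBuchholzKoteckyMuller2019, Ch. 6.2 (6.26)] -/
theorem subset_thicken (r : ℕ) (X : Finset (Fin d → ZMod M)) : X ⊆ thicken r X :=
  fun x hx => mem_thicken.2 ⟨x, hx, by rw [sub_self, supNorm_zero]; exact Nat.zero_le _⟩

/-- Thickening by `0` does nothing. [cite: AdamsBuchholzKoteckyMuller2019, Ch. 6.2 (6.25)] -/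
@[simp] theorem thicken_zero (X : Finset (Fin d → ZMod M)) : thicken 0 X = X := by
  ext y
  rw [mem_thicken]
  constructor
  · rintro ⟨x, hx, h⟩
    have h0 : supNorm (y - x) = 0 := Nat.le_zero.1 h
    have : y - x = 0 := by
      funext i
      have := natAbs_valMinAbs_le_supNorm (y - x) i
      rw [h0, Nat.le_zero, Int.natAbs_eq_zero, ZMod.valMinAbs_eq_zero] at this
      exact this
    rwa [sub_eq_zero.1 this]
  · exact fun hy => ⟨y, hy, by rw [sub_self, supNorm_zero]⟩

/-- The thickening of the empty set is empty. [cite: AdamsBuchholzKoteckyMuller2019, Ch. 6.2 (6.25)] -/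
@[simp] theorem thicken_empty (r : ℕ) : thicken r (∅ : Finset (Fin d → ZMod M)) = ∅ := by
  simp [thicken]

/-- Monotonicity in the set. [cite: AdamsBuchholzKoteckyMuller2019, Ch. 6.2 (6.25)] -/
theorem thicken_mono (r : ℕ) {X Y : Finset (Fin d → ZMod M)} (h : X ⊆ Y) :
    thicken r X ⊆ thicken r Y :=
  Finset.biUnion_subset_biUnion_of_subset_left _ h

/-- Monotonicity in the radius. [cite: AdamsBuchholzKoteckyMuller2019, Ch. 6.2 (6.25)] -/
theorem thicken_mono_rad {r r' : ℕ} (h : r ≤ r') (X : Finset (Fin d → ZMod M)) :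
    thicken r X ⊆ thicken r' X := fun y hy => by
  obtain ⟨x, hx, hxy⟩ := mem_thicken.1 hy
  exact mem_thicken.2 ⟨x, hx, hxy.trans h⟩

/-- Thickening distributes over unions: `(X ∪ Y) + Q = (X + Q) ∪ (Y + Q)`.
[cite: AdamsBuchholzKoteckyMuller2019, Lemma 7.6 (i) ((X ∪ Y)* = X* ∪ Y*)] -/
theorem thicken_union (r : ℕ) (X Y : Finset (Fin d → ZMod M)) :
    thicken r (X ∪ Y) = thicken r X ∪ thicken r Y := by
  ext z
  simp only [mem_thicken, Finset.mem_union, or_and_right, exists_or]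


/-- Thickening distributes over indexed unions (`X* = ⋃_{B ∈ 𝓑(X)} B*` for a polymer `X = ⋃ B`).
[cite: AdamsBuchholzKoteckyMuller2019, Ch. 6.2 (6.24)] -/
theorem thicken_biUnion {ι : Type*} [DecidableEq ι] (r : ℕ) (s : Finset ι)
    (f : ι → Finset (Fin d → ZMod M)) :
    thicken r (s.biUnion f) = s.biUnion fun i => thicken r (f i) := by
  ext z
  simp only [mem_thicken, Finset.mem_biUnion]
  constructor
  · rintro ⟨x, ⟨i, hi, hx⟩, h⟩; exact ⟨i, hi, x, hx, h⟩
  · rintro ⟨i, hi, x, hx, h⟩; exact ⟨x, ⟨i, hi, hx⟩, h⟩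

/-- **Iterated thickening**: `(X + [−r',r']^d) + [−r,r]^d ⊆ X + [−(r+r'), r+r']^d` (triangle
inequality; e.g. `(X*)^{++} ⊆ X + [−(2^d+2)L^{k−1}, …]^d`, [ABKM19] (7.46)).
[cite: AdamsBuchholzKoteckyMuller2019, Lemma 7.5 (iii) (7.46)] -/
theorem thicken_thicken (r r' : ℕ) (X : Finset (Fin d → ZMod M)) :
    thicken r (thicken r' X) ⊆ thicken (r + r') X := fun z hz => by
  obtain ⟨y, hy, hzy⟩ := mem_thicken.1 hz
  obtain ⟨x, hx, hyx⟩ := mem_thicken.1 hy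
  exact mem_thicken.2 ⟨x, hx, (supNorm_sub_le z y x).trans (add_le_add hzy hyx)⟩

/-- A thickening of a thickening contains the single thickening with the larger radius.
[cite: AdamsBuchholzKoteckyMuller2019, Ch. 6.2 (6.25)] -/
theorem thicken_subset_thicken_thicken (r r' : ℕ) (X : Finset (Fin d → ZMod M)) :
    thicken r X ⊆ thicken r (thicken r' X) :=
  thicken_mono r (subset_thicken r' X)

/-- The thickening of a singleton is the ball. [cite: AdamsBuchholzKoteckyMuller2019, Ch. 6.2 (6.25)] -/
@[simp] theorem thicken_singleton (r : ℕ) (x : Fin d → ZMod M) : thicken r {x} = ball r x := by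
  simp [thicken]

/-! ## Separation -/

omit [NeZero M] in
/-- **`dist_∞(X, Y) ≥ D`**: every pair `x ∈ X`, `y ∈ Y` has `|x − y|_∞ ≥ D`.
[cite: AdamsBuchholzKoteckyMuller2019, Ch. 6.2 (strictly disjoint polymers: dist(X,Y) > L^k)] -/
def Separated (D : ℕ) (X Y : Finset (Fin d → ZMod M)) : Prop :=
  ∀ x ∈ X, ∀ y ∈ Y, D ≤ supNorm (x - y)

namespace Separated

omit [NeZero M] in
/-- Symmetry. [cite: AdamsBuchholzKoteckyMuller2019, Ch. 6.2] -/
theorem symm {D : ℕ} {X Y : Finset (Fin d → ZMod M)} (h : Separated D X Y) : Separated D Y X :=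
  fun y hy x hx => by rw [supNorm_sub_comm]; exact h x hx y hy

omit [NeZero M] in
/-- Monotonicity in the sets. [cite: AdamsBuchholzKoteckyMuller2019, Ch. 6.2] -/
theorem mono {D : ℕ} {X X' Y Y' : Finset (Fin d → ZMod M)} (h : Separated D X Y) (hX : X' ⊆ X)
    (hY : Y' ⊆ Y) : Separated D X' Y' :=
  fun x hx y hy => h x (hX hx) y (hY hy)

omit [NeZero M] in
/-- Monotonicity in the distance. [cite: AdamsBuchholzKoteckyMuller2019, Ch. 6.2] -/
theorem of_le {D D' : ℕ} {X Y : Finset (Fin d → ZMod M)} (h : Separated D X Y) (hD : D' ≤ D) :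
    Separated D' X Y :=
  fun x hx y hy => hD.trans (h x hx y hy)

/-- **Separation of thickenings**: `dist(X + [−r,r]^d, Y + [−r',r']^d) ≥ dist(X, Y) − r − r'`
([ABKM19] (7.56): `dist(X*, Y*) ≥ L^{k+1} − 2(2^d+R)L^k`; proof of Lemma 7.6 (i):
`dist(X^{++}, Y^{++}) ≥ dist(X,Y) − 4L^k`). [cite: AdamsBuchholzKoteckyMuller2019, Lemma 7.6 (i) (7.56)] -/
theorem thicken {D r r' : ℕ} {X Y : Finset (Fin d → ZMod M)} (h : Separated (D + r + r') X Y) :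
    Separated D (thicken r X) (thicken r' Y) := by
  intro x' hx' y' hy'
  obtain ⟨x, hx, hxx⟩ := mem_thicken.1 hx'
  obtain ⟨y, hy, hyy⟩ := mem_thicken.1 hy'
  have h1 := h x hx y hy
  -- `|x − y| ≤ |x − x'| + |x' − y'| + |y' − y|`
  have h2 : supNorm (x - y) ≤ supNorm (x - x') + (supNorm (x' - y') + supNorm (y' - y)) :=
    (supNorm_sub_le x x' y).trans (Nat.add_le_add_left (supNorm_sub_le x' y' y) _)
  rw [supNorm_sub_comm x x'] at h2
  omega

omit [NeZero M] in
/-- Separated sets (`D ≥ 1`) are disjoint. [cite: AdamsBuchholzKoteckyMuller2019, Ch. 6.2] -/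
theorem disjoint {D : ℕ} (hD : 1 ≤ D) {X Y : Finset (Fin d → ZMod M)} (h : Separated D X Y) :
    Disjoint X Y := by
  rw [Finset.disjoint_left]
  intro x hx hy
  have := h x hx x hy
  rw [sub_self, supNorm_zero] at this
  omega

/-- **On the torus of side `M` two non-empty sets are never more than `M/2` apart**: if
`Separated D X Y` with `2D > M` then `X = ∅` or `Y = ∅` (so separation conditions at the last scale,
`¾L^{N+1} > L^N/2`, are vacuous). [cite: AdamsBuchholzKoteckyMuller2019, Theorem 7.1 (w4) at k = N] -/
theorem eq_empty_or_eq_empty {D : ℕ} (hD : M < 2 * D) {X Y : Finset (Fin d → ZMod M)}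
    (h : Separated D X Y) : X = ∅ ∨ Y = ∅ := by
  by_contra hne
  rw [not_or] at hne
  obtain ⟨x, hx⟩ := Finset.nonempty_iff_ne_empty.2 hne.1
  obtain ⟨y, hy⟩ := Finset.nonempty_iff_ne_empty.2 hne.2
  have h1 := h x hx y hy
  have h2 := two_mul_supNorm_le (x - y)
  omega

end Separated

/-! ## Counting -/

omit [NeZero M] in
/-- The residues with `|t| ≤ r` number at most `2r + 1` (symmetric representatives are injective;
the one-dimensional case of `#(x + [−r,r]^d) ≤ (2r+1)^d`). [cite: AdamsBuchholzKoteckyMuller2019, Lemma 7.7 (i)] -/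
theorem card_filter_natAbs_valMinAbs_le [NeZero M] (r : ℕ) :
    (univ.filter fun t : ZMod M => (t.valMinAbs).natAbs ≤ r).card ≤ 2 * r + 1 := by
  have hinj : Set.InjOn (ZMod.valMinAbs : ZMod M → ℤ)
      ↑(univ.filter fun t : ZMod M => (t.valMinAbs).natAbs ≤ r) :=
    fun a _ b _ hab => ZMod.injective_valMinAbs hab
  have hsub : (univ.filter fun t : ZMod M => (t.valMinAbs).natAbs ≤ r).image ZMod.valMinAbs ⊆
      Finset.Icc (-(r : ℤ)) r := by
    intro z hz
    obtain ⟨t, ht, rfl⟩ := Finset.mem_image.1 hz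
    rw [Finset.mem_filter] at ht
    have := ht.2
    rw [Finset.mem_Icc]
    omega
  calc (univ.filter fun t : ZMod M => (t.valMinAbs).natAbs ≤ r).card
      = ((univ.filter fun t : ZMod M => (t.valMinAbs).natAbs ≤ r).image ZMod.valMinAbs).card :=
        (Finset.card_image_of_injOn hinj).symm
    _ ≤ (Finset.Icc (-(r : ℤ)) r).card := Finset.card_le_card hsub
    _ = 2 * r + 1 := by rw [Int.card_Icc]; omega

/-- **`#(x + [−r,r]^d) ≤ (2r+1)^d`**. [cite: AdamsBuchholzKoteckyMuller2019, Lemma 7.7 (i) (|X^{+++}| ≤ (7R+1)^d|X|_0)] -/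
theorem card_ball_le (r : ℕ) (x : Fin d → ZMod M) : (ball r x).card ≤ (2 * r + 1) ^ d := by
  classical
  -- `ball r x` is the translate by `x` of the cube `{z : ∀ i, |z_i| ≤ r}`
  set S : Finset (ZMod M) := univ.filter fun t : ZMod M => (t.valMinAbs).natAbs ≤ r with hS
  have hsub : ball r x ⊆ (Fintype.piFinset fun _ : Fin d => S).image fun z => z + x := by
    intro y hy
    rw [mem_ball] at hy
    refine Finset.mem_image.2 ⟨y - x, ?_, sub_add_cancel y x⟩
    rw [Fintype.mem_piFinset]
    intro i
    rw [hS, Finset.mem_filter]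
    exact ⟨mem_univ _, (natAbs_valMinAbs_le_supNorm (y - x) i).trans hy⟩
  calc (ball r x).card ≤ ((Fintype.piFinset fun _ : Fin d => S).image fun z => z + x).card :=
        Finset.card_le_card hsub
    _ ≤ (Fintype.piFinset fun _ : Fin d => S).card := Finset.card_image_le
    _ = ∏ _i : Fin d, S.card := Fintype.card_piFinset _
    _ = S.card ^ d := by rw [Finset.prod_const, Finset.card_univ, Fintype.card_fin]
    _ ≤ (2 * r + 1) ^ d := Nat.pow_le_pow_left (card_filter_natAbs_valMinAbs_le r) d

/-- `#(X + [−r,r]^d) ≤ #X · (2r+1)^d`. [cite: AdamsBuchholzKoteckyMuller2019, Lemma 7.7 (i)] -/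
theorem card_thicken_le (r : ℕ) (X : Finset (Fin d → ZMod M)) :
    (thicken r X).card ≤ X.card * (2 * r + 1) ^ d := by
  unfold thicken
  exact Finset.card_biUnion_le.trans (by
    rw [← smul_eq_mul, ← Finset.sum_const]
    exact Finset.sum_le_sum fun x _ => card_ball_le r x)

/-- A point within `r` of `X` meets `X` inside its ball: `y ∈ X + [−r,r]^d ↔ (ball r y ∩ X) ≠ ∅`.
[cite: AdamsBuchholzKoteckyMuller2019, Ch. 6.2 (6.25)] -/
theorem mem_thicken_iff_nonempty {r : ℕ} {X : Finset (Fin d → ZMod M)} {y : Fin d → ZMod M} :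
    y ∈ thicken r X ↔ (X.filter fun x => x ∈ ball r y).Nonempty := by
  rw [mem_thicken]
  constructor
  · rintro ⟨x, hx, h⟩
    exact ⟨x, Finset.mem_filter.2 ⟨hx, by rw [mem_ball, supNorm_sub_comm]; exact h⟩⟩
  · rintro ⟨x, hx⟩
    rw [Finset.mem_filter, mem_ball, supNorm_sub_comm] at hx
    exact ⟨x, hx.1, hx.2⟩

end Literature.MathematicalPhysics.StatisticalMechanics.TorusPolymer
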